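import Mathlib.Analysis.Matrix.Order
import Mathlib.Algebra.Order.Chebyshev
import Summits.Ventures.CertifiedManyBodySolver.Conjectures.OneBodySection

/-!
# Ring saturation one site early, the flat family `ν = 1/L`: `E¹_[S](2/L) = −4/L` for `2 ≤ S ≤ L`

HONEST FRAMING: first certified bounds; not a superconductivity verdict; every number certified
or labelled float.  (Venture `CertifiedManyBodySolver`, programme `hubbard-alg`, team M1 seat 4,
structure notes `STRUCTURE-TM1-doped.md`, entries C-M1D-3 (C) and T-M1D.26 / C-M1D-17 "ring
saturation one site early"; same setting and notation as `OneBodySection.lean`.)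

C-M1D-17 asserts that for every ring length `L` and per-species filling `ν` with `N = Lν ∈ ℕ` the
translation-invariant one-body window bound on `L − 1` sites already equals the optimally twisted
free `L`-ring value `−(4/L)·sin(πν)/sin(π/L)`.  For ONE occupied shell, `N = 1` i.e. `ν = 1/L`,
the ring value is `−4/L` and the statement is elementary and holds for EVERY window `2 ≤ S ≤ L`:
`g 1 ≤ g 0 = 1/L` by the `2 × 2` minor (`hop_le_diag` of `OneBodySection.lean`), and the flat
sequence `g ≡ 1/L` — the `k = 0` shell of the `L`-ring restricted to the window — is feasible
exactly when `S·(1/L) ≤ 1` (its section is `(1/L)·𝟙𝟙ᵀ`, and `1 − (1/L)·𝟙𝟙ᵀ ⪰ 0` on `S` sites is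
Cauchy–Schwarz `(Σx)² ≤ S·Σx²` together with `S ≤ L`).  This file proves

* `flat_posSemidef`, `flat_le_one` — `0 ≤ a` and `a·S ≤ 1` make the flat sequence `g ≡ a`
  feasible: `0 ⪯ T_S(a) ⪯ 1`.  This is the SUFFICIENCY half of the band-bottom threshold
  C-M1D-3 (C), whose necessity half is `threshold_of_hop_eq` (`OneBodySection.lean`): together,
  `E¹_[S](n) = −2n ⇔ n·S ≤ 2`;
* `hop_le_of_flat`, `ringSaturation_flat` — the C-M1D-17 family `(L, 1/L)`, all `L ≥ 2`, for every
  window `2 ≤ S ≤ L`: `g 0 = 1/L ∧ 0 ⪯ T_S(g) ⇒ g 1 ≤ 1/L`, attained with `0 ⪯ T_S ⪯ 1`, i.e.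
  `E¹_[S](2/L) = −4/L`.

(The non-trivial instances with `N ≥ 2` shells are the exact algebraic certificates of
`ToeplitzWindowRing8.lean` `(8, ¼)`, `ToeplitzWindowSeven38.lean` `(8, ⅜)`,
`ToeplitzWindowEleven.lean` / `ToeplitzWindowTwelve.lean` `(12, ¼)` and
`ToeplitzWindowEleven512.lean` `(12, 5/12)`.)
-/

namespace Summit.Ventures.CertifiedManyBodySolver.Conjectures

open Matrix

variable {S : ℕ}

/-- The section of a constant sequence is the constant matrix. -/
theorem toeplitzSection_flat (a : ℝ) :
    toeplitzSection S (fun _ => a) = Matrix.of fun _ _ : Fin S => a := by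
  ext x y; simp

/-- The constant matrix is symmetric. -/
theorem flat_isHermitian (a : ℝ) : (Matrix.of fun _ _ : Fin S => a).IsHermitian := by
  ext; simp

/-- The constant matrix acts by `x ↦ (a·Σx)·𝟙`. -/
theorem flat_mulVec (a : ℝ) (x : Fin S → ℝ) :
    (Matrix.of fun _ _ : Fin S => a) *ᵥ x = fun _ => a * ∑ j, x j := by
  funext i; simp [Matrix.mulVec, dotProduct, Finset.mul_sum]

/-- The quadratic form of the constant matrix: `xᵀ(a·𝟙𝟙ᵀ)x = a·(Σx)²`. -/
theorem flat_quadForm (a : ℝ) (x : Fin S → ℝ) :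
    star x ⬝ᵥ ((Matrix.of fun _ _ : Fin S => a) *ᵥ x) = a * (∑ j, x j) ^ 2 := by
  rw [flat_mulVec]
  simp only [dotProduct, star_trivial]
  rw [← Finset.sum_mul]
  ring

/-- `0 ⪯ T_S(a)` for the flat sequence `g ≡ a`, `a ≥ 0`. -/
theorem flat_posSemidef {a : ℝ} (ha : 0 ≤ a) : (toeplitzSection S (fun _ => a)).PosSemidef := by
  rw [toeplitzSection_flat]
  refine Matrix.PosSemidef.of_dotProduct_mulVec_nonneg (flat_isHermitian a) fun x => ?_
  rw [flat_quadForm]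
  positivity

/-- `T_S(a) ⪯ 1` for the flat sequence when `a ≥ 0` and `a·S ≤ 1` (Cauchy–Schwarz
`(Σx)² ≤ S·Σx²`): the sufficiency half of the band-bottom threshold C-M1D-3 (C). -/
theorem flat_le_one {a : ℝ} (ha : 0 ≤ a) (haS : a * S ≤ 1) :
    (1 - toeplitzSection S (fun _ => a)).PosSemidef := by
  rw [toeplitzSection_flat]
  refine Matrix.PosSemidef.of_dotProduct_mulVec_nonneg
    ((Matrix.isHermitian_one).sub (flat_isHermitian a)) fun x => ?_
  rw [Matrix.sub_mulVec, Matrix.one_mulVec, dotProduct_sub, flat_quadForm]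
  have hcs : (∑ j, x j) ^ 2 ≤ (Finset.univ : Finset (Fin S)).card * ∑ j, x j ^ 2 :=
    sq_sum_le_card_mul_sum_sq (s := Finset.univ) (f := x)
  simp only [Finset.card_univ, Fintype.card_fin] at hcs
  have hx2 : 0 ≤ ∑ j, x j ^ 2 := Finset.sum_nonneg fun j _ => sq_nonneg _
  have hxx : star x ⬝ᵥ x = ∑ j, x j ^ 2 := by simp [dotProduct, sq]
  rw [hxx]
  have h1 : a * (∑ j, x j) ^ 2 ≤ a * ((S : ℝ) * ∑ j, x j ^ 2) := mul_le_mul_of_nonneg_left hcs ha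
  have h2 : (a * S) * ∑ j, x j ^ 2 ≤ ∑ j, x j ^ 2 := mul_le_of_le_one_left hx2 haS
  have h3 : a * ((S : ℝ) * ∑ j, x j ^ 2) = (a * S) * ∑ j, x j ^ 2 := by ring
  linarith

/-- Both constraints at once: the flat sequence `g ≡ a` is feasible iff-direction `⇐` of C-M1D-3 (C). -/
theorem flat_feasible {a : ℝ} (ha : 0 ≤ a) (haS : a * S ≤ 1) :
    (toeplitzSection S (fun _ => a)).PosSemidef ∧ (1 - toeplitzSection S (fun _ => a)).PosSemidef :=
  ⟨flat_posSemidef ha, flat_le_one ha haS⟩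

/-- **C-M1D-17, family `ν = 1/L` — upper bound.**  On any window `S ≥ 2`: `g 0 = 1/L` and
`0 ⪯ T_S(g)` give `g 1 ≤ 1/L`, i.e. `E¹_[S](2/L) ≥ −4/L`, the `L`-ring one-shell value. -/
theorem hop_le_of_flat (hS : 2 ≤ S) {L : ℕ} {g : ℕ → ℝ} (hT : (toeplitzSection S g).PosSemidef)
    (h0 : g 0 = 1 / L) : g 1 ≤ 1 / L :=
  h0 ▸ hop_le_diag hS hT

/-- **C-M1D-17, family `ν = 1/L` — attainment** for every window `S ≤ L` (in particular `S = L − 1`):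
the flat sequence `g ≡ 1/L` (the `k = 0` shell of the `L`-ring) is feasible with `g 1 = 1/L`, so
`E¹_[S](2/L) = −4/L = −(4/L)·sin(π·(1/L))/sin(π/L)`. -/
theorem ringSaturation_flat {L : ℕ} (hL : 0 < L) (hSL : S ≤ L) :
    ∃ g : ℕ → ℝ, g 0 = 1 / L ∧ g 1 = 1 / L ∧
      (toeplitzSection S g).PosSemidef ∧ (1 - toeplitzSection S g).PosSemidef := by
  have hLr : (0 : ℝ) < L := by exact_mod_cast hL
  have hSLr : (S : ℝ) ≤ L := by exact_mod_cast hSL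
  refine ⟨fun _ => 1 / L, rfl, rfl, flat_posSemidef (by positivity), flat_le_one (by positivity) ?_⟩
  rw [div_mul_eq_mul_div, one_mul]
  exact (div_le_one hLr).mpr hSLr

end Summit.Ventures.CertifiedManyBodySolver.Conjectures
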